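import Literature.Computability.AlgebraicComplexity.BorderRankMatMulThreeKernel
import Literature.Computability.AlgebraicComplexity.BorderRankMatMulThreeEnumData
import HarnessLib

/-!
# Borel-fixed `(110)`-candidates of `⟨3,3,3⟩`: kernel run of the test procedure, part 6

Topic `Literature/Computability/AlgebraicComplexity`. The kernel evaluates the verdict
`MatMul3.Ker.verdictH` of `BorderRankMatMulThreeKernel.lean` (at most one free block, and for every
variant of the free diagonal the hinted test `(210)`/`(120)` has certified dimension `≤ 15`) on the
killed profiles `MatMul3.killedProfs[185 .. 220)` of `BorderRankMatMulThreeEnumData.lean`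
(`decide +kernel`, in sub-ranges sized to the default heartbeat budget; the twelve parts are
assembled in `BorderRankMatMulThreeVerdictRun.lean`). Soundness of the verdict is
`MatMul3.IsAdmissible.test_le_of_verdictH` (`BorderRankMatMulThreeVerdict.lean`).

## References

* A. Conner, A. Harper, J. M. Landsberg, *New lower bounds for matrix multiplication and `det₃`*,
  Forum Math. Pi 11 (2023) e17, arXiv:1911.07981 — §6. [ConnerHarperLandsberg2023]
-/

namespace Literature.Computability.AlgebraicComplexity

namespace BorderApolarity

namespace MatMul3

/-- Kernel run on the killed profiles of index `185 ≤ i < 192`. [cite: ConnerHarperLandsberg2023, §6] -/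
theorem verdictRun6_1 : ∀ i : ℕ, 185 ≤ i → i < 192 →
    Ker.verdictH (killedProfs.getD i ([], [])).1 (killedProfs.getD i ([], [])).2 = true := by
  decide +kernel

/-- Kernel run on the killed profiles of index `192 ≤ i < 199`. [cite: ConnerHarperLandsberg2023, §6] -/
theorem verdictRun6_2 : ∀ i : ℕ, 192 ≤ i → i < 199 →
    Ker.verdictH (killedProfs.getD i ([], [])).1 (killedProfs.getD i ([], [])).2 = true := by
  decide +kernel

/-- Kernel run on the killed profiles of index `199 ≤ i < 206`. [cite: ConnerHarperLandsberg2023, §6] -/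
theorem verdictRun6_3 : ∀ i : ℕ, 199 ≤ i → i < 206 →
    Ker.verdictH (killedProfs.getD i ([], [])).1 (killedProfs.getD i ([], [])).2 = true := by
  decide +kernel

/-- Kernel run on the killed profiles of index `206 ≤ i < 213`. [cite: ConnerHarperLandsberg2023, §6] -/
theorem verdictRun6_4 : ∀ i : ℕ, 206 ≤ i → i < 213 →
    Ker.verdictH (killedProfs.getD i ([], [])).1 (killedProfs.getD i ([], [])).2 = true := by
  decide +kernel

/-- Kernel run on the killed profiles of index `213 ≤ i < 220`. [cite: ConnerHarperLandsberg2023, §6] -/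
theorem verdictRun6_5 : ∀ i : ℕ, 213 ≤ i → i < 220 →
    Ker.verdictH (killedProfs.getD i ([], [])).1 (killedProfs.getD i ([], [])).2 = true := by
  decide +kernel

/-- **Kernel run, part 6**: the verdict holds for the killed profiles of index `185 ≤ i < 220`.
[cite: ConnerHarperLandsberg2023, §6] -/
theorem verdictRun6 (i : ℕ) (h₁ : 185 ≤ i) (h₂ : i < 220) :
    Ker.verdictH (killedProfs.getD i ([], [])).1 (killedProfs.getD i ([], [])).2 = true := by
  by_cases g1 : i < 192
  · exact verdictRun6_1 i (by omega) g1
  by_cases g2 : i < 199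
  · exact verdictRun6_2 i (by omega) g2
  by_cases g3 : i < 206
  · exact verdictRun6_3 i (by omega) g3
  by_cases g4 : i < 213
  · exact verdictRun6_4 i (by omega) g4
  exact verdictRun6_5 i (by omega) h₂

end MatMul3

end BorderApolarity

end Literature.Computability.AlgebraicComplexity
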